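import Literature.NumberTheory.LFunctions.SelbergFujiiMoments
import HarnessLib

/-!
# Selberg–Fujii small gaps straight from the first moment (Titchmarsh §9.26) — proofs

Trunk T-ANT (`Literature/NumberTheory/LFunctions`). Proofs only (no definitions, no named facts).
Fourth file of the Selberg–Fujii cluster (`ZeroGaps.lean`: the named facts
`Literature.NumberTheory.LFunctions.selberg_fujii_large_gaps` (9.25.5) and `…small_gaps` (9.25.6);
`ZeroGapsProofs.lean`: small gaps from large gaps, last paragraph of §9.26;
`SelbergFujiiLargeGaps.lean`: large gaps from the first-moment bound (9.26.1) and (9.25.4)₂;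
`SelbergFujiiMoments.lean`: (9.26.1) from Fujii's moment estimates (9.25.2)–(9.25.3)).

## Main results

* `Literature.NumberTheory.LFunctions.selberg_fujii_small_gaps_of_first_moment` — PROVED: the
  small-gap fact (9.25.6) follows from the first-moment bound (9.26.1)
  `∫_T^{2T} |N(t + 2πλ/log T) − N(t) − λ| dt ≥ c T` (`T ≥ T₁`, uniformly in `1 ≤ λ ≤ 2`) ALONE,
  i.e. WITHOUT the gap second moment (9.25.4)₂ that the large-gap half consumes
  (`selberg_fujii_large_gaps_of_first_moment`). In §9.26 the small gaps are deduced from the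
  large-gap count `#S ≫ N(T)` ((9.26.2), which needs (9.25.4)₂ through Cauchy–Schwarz); here they
  are deduced from the total LENGTH `Σ_{n ∈ S} (γ_{n+1} − γ_n) ≥ m(I) ≫ T` of the large gaps,
  which §9.26 obtains before Cauchy–Schwarz, so (9.25.4) drops out.
* `Literature.NumberTheory.LFunctions.SelbergFujii.first_moment_of_abs_moment` — PROVED: (9.26.1)
  from the weakest analytic input of Heath-Brown's sketch, an `L¹` lower bound for
  `S(t + h) − S(t)` on `[T, 2T]` at ONE fixed scale `h ≍ M/log T`:
  `∃ M ∈ ℕ, M ≥ 1, ∃ c₁ > 0, ∀ T ≥ T₀, ∀ h, 2πM ≤ h log T ≤ 4πM → ∫_T^{2T} |S(t+h) − S(t)| dt ≥ c₁ T`.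
  (§9.26 gets this from (9.25.2)–(9.25.3) and Hölder; `SelbergFujii.first_moment_of_moments`
  formalises that passage.)
* `Literature.NumberTheory.LFunctions.selberg_fujii_small_gaps_of_abs_moment`,
  `…large_gaps_of_abs_moment`, `…small_gaps_of_moments'` — the compositions: the small-gap fact
  from the `L¹` bound alone, the large-gap fact from the `L¹` bound and (9.25.4)₂, and the
  small-gap fact from (9.25.2) + (9.25.3)₂ (no (9.25.4)).

After this file the trust base of `selberg_fujii_small_gaps` is exactly the displayed `L¹` bound
(hypothesis `hS` of `selberg_fujii_small_gaps_of_abs_moment`), an unconditional theorem of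
Selberg (1946) / Fujii (1975) resting on Selberg's approximate formula for `S(t)` and his density
theorem `N(σ, T) ≪ T^{1 − (σ − 1/2)/4} log T` (Titchmarsh Thm. 9.19 (C), stated there without
proof); it is NOT proved in the tree and is NOT vendored as a named fact (D-0026).

## The proof of `selberg_fujii_small_gaps_of_first_moment` (explicit constants)

Let `c ≤ 1` be the constant of (9.26.1) (shrink it), `λ = 1 + c/4`, `ℓ = 2πλ/log T`,
`I = {t ∈ [T, 2T] : N(t + ℓ) = N(t)}`, `S = {n < N(2T) : γ_n ≥ T/2, γ_{n+1} − γ_n ≥ ℓ}`,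
`G = Σ_{n ∈ S} (γ_{n+1} − γ_n)`, `ν = c²/160`, `μ = 1 − ν`, `w = 2πμ/log 2T`,
`V = {n < N(2T) : δ_n ≤ μ}` (`δ_n` the normalised gap).
* Steps 1–4 of `selberg_fujii_large_gaps_of_first_moment` verbatim: `m(I) ≥ cT/8` and
  `m(I) ≤ G` (`SelbergFujii.integral_abs_le`, `…integral_zetaZeroCount_shift_sub_le`,
  `…volume_real_le_sum_gaps`; Riemann–von Mangoldt only).
* `Σ_{n < N(2T)} (γ_{n+1} − γ_n) = γ_{N(2T)} − γ_0 ≤ 2T + C₀` (bounded gaps, `N(2T) < N(2T + C₀)`).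
* For `n < N(2T)`, `n ∉ S`, `δ_n > μ`: `γ_{n+1} − γ_n = 2πδ_n/log γ_n ≥ w` (`γ_n ≤ 2T`); hence
  `Σ_{n < N(2T)} (γ_{n+1} − γ_n) ≥ G + w (N(2T) − #S − #V)`, while `#S · ℓ ≤ G` gives
  `w #S ≤ (μ/λ) G`, and Riemann–von Mangoldt gives `w N(2T) ≥ 2Tμ − 6T/log 2T − 2πK₀`.
* So `w #V ≥ (1 − μ/λ) G − 2νT − (6T/log 2T + 2πK₀ + C₀) ≥ (c/5)(cT/8) − c²T/80 − 2c²T/480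
  = c²T/120`, i.e. `#V ≥ c² T log 2T/(240π) ≥ (c²/(640πC')) N(2T)` (`N(2T) ≤ 2C' T log 2T`).

## Programme for the remaining input (recorded for the seats on this cluster; nothing below is
vendored)

The hypothesis `hS` is the whole remaining debt of BOTH gap facts ((9.25.4)₂, needed only for
the large gaps, follows from the `k = 2` case of (9.25.3) by Chebyshev on dyadic gap classes).
Every known proof of `hS` goes through
1. Selberg's density theorem near the critical line in its SHARP form
   `#{ρ : β ≥ 1/2 + a/log T, T < γ ≤ 2T} ≤ C e^{−κa} T log T` for `A₀ ≤ a ≤ 7 log log T`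
   (Titchmarsh Thm. 9.19 (C); Selberg 1946 Thm. 1) — a loss of any unbounded factor here (e.g.
   the `log⁵ T` of Thm. 9.19 (A)/(B), or the integrated form Thm. 9.24
   `Σ_{γ ≤ T} |β − 1/2| = O(T)`) is NOT sufficient: zeros at normalised distance `a ∈ [M″, log log T]`
   from the line enter the `L¹` error with weight `e^{3a/M″}` (Selberg's `x^{3(β−1/2)}` windows,
   `x = T^{1/M″}`), and the main term only grows like `(log(M/M″))^{1/2}`;
2. a mollified second moment just to the right of the line with exponential saving,
   `∫_T^{2T} |ζψ(1/2 + a/log T + it)|² dt ≤ T (1 + C e^{−κa})` (`ψ` of length `T^θ`), which gives 1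
   by Littlewood's lemma — the twisted second moment technology of Titchmarsh Lemmas 9.21–9.23 /
   Thm. 9.24, moved off the line;
3. Selberg's approximate formula `S(t) = −π⁻¹ Σ_{p < x} p^{−1/2} sin(t log p) + E`,
   `∫_T^{2T} |E| ≪ T` (via `σ_{x,t}` and 1), or equivalently a smoothed explicit formula
   (Guinand–Weil, `explicit_formula_holds`) with a Fejér-type kernel of bandwidth `log T/M″` whose
   off-line zero term is controlled by 1 and Thm. 9.24;
4. mean values of the prime polynomial `Σ_{p<x} p^{−1/2}(p^{−ih} − 1)p^{−it}` (second moment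
   `≍ T log(h log x)` by Mertens, fourth `≪ T log²(h log x)` by the mean value theorem), whence
   `∫_T^{2T} |S(t+h) − S(t)| ≥ T (c (log M/M″)^{1/2} − C(M″))` and `hS` with `M` large.

## References

* E. C. Titchmarsh, *The Theory of the Riemann Zeta-Function*, 2nd ed. revised by
  D. R. Heath-Brown (1986), §9.25 (9.25.2)–(9.25.6), §9.26, Thm. 9.4, Thms. 9.19 and 9.24.
  [key `Titchmarsh1986`]
* A. Fujii, *On the difference between r consecutive ordinates of the zeros of the Riemann zeta
  function*, Proc. Japan Acad. 51 (1975), 741–743.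
* A. Selberg, *Contributions to the theory of the Riemann zeta-function*, Arch. Math. Naturvid.
  48 (1946), no. 5, 89–155.
-/

noncomputable section

open Real MeasureTheory Set Filter Asymptotics

namespace Literature.NumberTheory.LFunctions

namespace SelbergFujii

/-! ### From the `L¹` bound for `S(t + h) − S(t)` to the first moment of the zero count -/

/-- Steps B–C of §9.26 from an `L¹` bound: if `∫_T^{2T} |S(t+h) − S(t)| dt ≥ c₁ T` and
`h ≤ c₁/2` (`0 ≤ h ≤ 1`, `T ≥ 1`), then `∫_T^{2T} |N(t+h) − N(t) − h log T/(2π)| dt ≥ c₁ T/2`,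
since `|N(t+h) − N(t) − h log T/2π| ≥ |S(t+h) − S(t)| − h` on `[T, 2T]`
(`SelbergFujii.abs_zetaArgS_sub_le`). [cite: Titchmarsh1986, §9.26] -/
theorem le_integral_abs_zetaZeroCount_sub_of_abs {T h c₁ : ℝ} (hT : 1 ≤ T) (hh : 0 ≤ h)
    (hh1 : h ≤ 1) (hhc : h ≤ c₁ / 2)
    (hI1 : c₁ * T ≤ ∫ t in T..2 * T, |zetaArgS (t + h) - zetaArgS t|) :
    c₁ * T / 2 ≤ ∫ t in T..2 * T,
      |(zetaZeroCount (t + h) : ℝ) - zetaZeroCount t - h * Real.log T / (2 * π)| := by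
  have hmN := monotone_zetaZeroCount_real
  have hmNh : Monotone fun t : ℝ ↦ (zetaZeroCount (t + h) : ℝ) := fun a b hab ↦ hmN (by linarith)
  have hiG : IntervalIntegrable
      (fun t ↦ (zetaZeroCount (t + h) : ℝ) - zetaZeroCount t - h * Real.log T / (2 * π))
      volume T (2 * T) :=
    (hmNh.intervalIntegrable.sub hmN.intervalIntegrable).sub intervalIntegrable_const
  have hFm : Measurable fun t ↦ zetaArgS (t + h) - zetaArgS t :=
    (measurable_zetaArgS.comp (measurable_id.add_const h)).sub measurable_zetaArgS
  obtain ⟨CF, -, hCF⟩ := exists_abs_zetaArgS_sub_le T (2 * T) hh hh1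
  have hiF : IntervalIntegrable (fun t ↦ |zetaArgS (t + h) - zetaArgS t|) volume T (2 * T) :=
    intervalIntegrable_of_abs_le (by linarith) (continuous_abs.measurable.comp hFm) (C := CF)
      fun t ht ↦ by rw [abs_abs]; exact hCF t ht
  have hpt : ∀ t ∈ Icc T (2 * T), |zetaArgS (t + h) - zetaArgS t| - h ≤
      |(zetaZeroCount (t + h) : ℝ) - zetaZeroCount t - h * Real.log T / (2 * π)| :=
    fun t ht ↦ abs_zetaArgS_sub_le hT ht.1 ht.2 hh hh1
  have hmono := intervalIntegral.integral_mono_on (by linarith) (hiF.sub intervalIntegrable_const)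
    hiG.abs hpt
  rw [intervalIntegral.integral_sub hiF intervalIntegrable_const, intervalIntegral.integral_const,
    smul_eq_mul] at hmono
  have h2 : (2 * T - T) * h ≤ c₁ * T / 2 := by
    rw [show 2 * T - T = T by ring]
    calc T * h ≤ T * (c₁ / 2) := mul_le_mul_of_nonneg_left hhc (by linarith)
      _ = c₁ * T / 2 := by ring
  linarith

/-- **Titchmarsh §9.26, first step, from the `L¹` bound.** If for some fixed `M ∈ ℕ`, `M ≥ 1`,
and `c₁ > 0` one has `∫_T^{2T} |S(t+h) − S(t)| dt ≥ c₁ T` for all large `T` and all `h` with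
`2πM ≤ h log T ≤ 4πM` (§9.26 derives this from Fujii's (9.25.2)–(9.25.3) by Hölder's inequality,
for `M` a sufficiently large constant), then (9.26.1) holds: for some `c > 0` and all large `T`,
`∫_T^{2T} |N(t + 2πλ/log T) − N(t) − λ| dt ≥ c T` uniformly in `1 ≤ λ ≤ 2`. The passage is
`S = N − θ/π − 1`, `θ(t+h) − θ(t) = (h/2) log T + O(h)` on `[T, 2T]`, and the telescoping
`h = Mℓ`, `ℓ = 2πλ/log T` of §9.26 (`SelbergFujii.integral_abs_telescope_le`); here `c = c₁/(8M)`.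
[cite: Titchmarsh1986, §9.26 (9.26.1)] -/
theorem first_moment_of_abs_moment
    (hS : ∃ M : ℕ, 1 ≤ M ∧ ∃ c₁ : ℝ, 0 < c₁ ∧ ∃ T₀ : ℝ, ∀ T : ℝ, T₀ ≤ T → ∀ h : ℝ,
      2 * π * M ≤ h * Real.log T → h * Real.log T ≤ 4 * π * M →
        c₁ * T ≤ ∫ t in T..2 * T, |zetaArgS (t + h) - zetaArgS t|) :
    ∃ c : ℝ, 0 < c ∧ ∃ T₁ : ℝ, ∀ T : ℝ, T₁ ≤ T → ∀ l : ℝ, 1 ≤ l → l ≤ 2 →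
      c * T ≤ ∫ t in T..2 * T,
        |(zetaZeroCount (t + 2 * π * l / Real.log T) : ℝ) - zetaZeroCount t - l| := by
  obtain ⟨M, hM1, c₁, hc₁, T₂, hS⟩ := hS
  obtain ⟨K₁, hK₁, T₅, hT₅1, hK₁5⟩ := exists_zetaZeroCount_add_one_sub_le
  have hπ : 3 < π := Real.pi_gt_three
  have hM : (1 : ℝ) ≤ M := by exact_mod_cast hM1
  have hmN := monotone_zetaZeroCount_real
  obtain ⟨E₁, hE₁⟩ : ∃ E₁ : ℝ, E₁ = 4 * π * M * (2 * K₁ + 1) := ⟨_, rfl⟩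
  have hE₁pos : 0 < E₁ := by rw [hE₁]; positivity
  refine ⟨c₁ / (8 * M), by positivity,
    max (max T₂ (max T₅ 2)) (max (Real.exp (4 * π * (M + 1)))
      (max (Real.exp (8 * π * M / c₁)) (8 * M * E₁ / c₁))), fun T hT l hl1 hl2 ↦ ?_⟩
  simp only [max_le_iff] at hT
  obtain ⟨⟨hT2, hT5, hT2'⟩, hTe, hTc, hTE⟩ := hT
  have hT1 : 1 ≤ T := by linarith only [hT2']
  have hlogT : 4 * π * (M + 1) ≤ Real.log T := by
    rw [← Real.log_exp (4 * π * (M + 1))]; exact Real.log_le_log (Real.exp_pos _) hTe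
  have h24 : (24 : ℝ) ≤ 4 * π * (M + 1) := by
    nlinarith only [hπ, hM, mul_nonneg (by linarith only [hπ] : (0 : ℝ) ≤ π - 3)
      (by linarith only [hM] : (0 : ℝ) ≤ M + 1)]
  have hlogpos : 0 < Real.log T := by linarith only [hlogT, h24]
  have hlogne : Real.log T ≠ 0 := hlogpos.ne'
  have hlogc : 8 * π * M / c₁ ≤ Real.log T := by
    rw [← Real.log_exp (8 * π * M / c₁)]; exact Real.log_le_log (Real.exp_pos _) hTc
  have hln2 : Real.log 2 < 1 := by have := Real.log_two_lt_d9; linarith only [this]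
  have hlog2T : Real.log (2 * T) ≤ 2 * Real.log T := by
    rw [Real.log_mul (by norm_num) (by positivity)]; linarith only [hln2, hlogT, h24]
  -- `ℓ = 2πl/log T`, `h = M ℓ`, `u = h log T = 2πMl ∈ [2πM, 4πM]`
  set ℓ : ℝ := 2 * π * l / Real.log T with hℓ
  have hℓpos : 0 < ℓ := by positivity
  have hu : M * ℓ * Real.log T = 2 * π * M * l := by rw [hℓ]; field_simp
  have hπM : 0 ≤ 2 * π * M := by positivity
  have hu1 : 2 * π * M ≤ M * ℓ * Real.log T := by
    rw [hu]; linarith only [mul_le_mul_of_nonneg_left hl1 hπM]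
  have hu2 : M * ℓ * Real.log T ≤ 4 * π * M := by
    rw [hu]; linarith only [mul_le_mul_of_nonneg_left hl2 hπM]
  have hMℓ1 : (M + 1) * ℓ ≤ 1 := by
    rw [hℓ, mul_div_assoc', div_le_one hlogpos]
    have : (M + 1) * (2 * π * l) ≤ (M + 1) * (4 * π) :=
      mul_le_mul_of_nonneg_left (by nlinarith only [hl2, Real.pi_pos]) (by linarith only [hM])
    linarith only [this, hlogT]
  have hMℓ0 : 0 ≤ (M : ℝ) * ℓ := by positivity
  have hh1 : M * ℓ ≤ 1 := by linarith only [hMℓ1, hℓpos.le]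
  have hhc : M * ℓ ≤ c₁ / 2 := by
    rw [le_div_iff₀ two_pos]
    have h8 : 8 * π * M ≤ c₁ * Real.log T := by
      have := (div_le_iff₀ hc₁).1 hlogc; linarith only [this]
    have h9 : M * ℓ * 2 * Real.log T ≤ c₁ * Real.log T := by
      have e9 : M * ℓ * 2 * Real.log T = 2 * (M * ℓ * Real.log T) := by ring
      rw [e9]; linarith only [hu2, h8]
    exact le_of_mul_le_mul_right h9 hlogpos
  -- Steps B–C from the `L¹` bound
  have hI1 := hS T hT2 (M * ℓ) hu1 hu2
  have hJ := le_integral_abs_zetaZeroCount_sub_of_abs hT1 hMℓ0 hh1 hhc hI1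
  -- Step D
  have hD := integral_abs_telescope_le (M := M) (by linarith only [hT1] : (0 : ℝ) ≤ T) hℓpos.le
    (by linarith only [hl1] : (0 : ℝ) ≤ l) hl2 hMℓ1
  have e : M * ℓ * Real.log T / (2 * π) = M * l := by rw [hu]; field_simp
  rw [e] at hJ
  -- the tail constant
  have htail : (M : ℝ) * ℓ * ((zetaZeroCount (2 * T + 1) : ℝ) - zetaZeroCount (2 * T) + 2) ≤ E₁ := by
    have hK2T := hK₁5 (2 * T) (by linarith only [hT5, hT2'])
    have h4 : K₁ * Real.log (2 * T) ≤ K₁ * (2 * Real.log T) :=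
      mul_le_mul_of_nonneg_left hlog2T hK₁.le
    have h5 : (M : ℝ) * ℓ * ((zetaZeroCount (2 * T + 1) : ℝ) - zetaZeroCount (2 * T) + 2) ≤
        M * ℓ * (2 * K₁ * Real.log T + 2) :=
      mul_le_mul_of_nonneg_left (by linarith only [hK2T, h4]) hMℓ0
    have e2 : (M : ℝ) * ℓ * (2 * K₁ * Real.log T + 2) =
        2 * π * M * l * (2 * K₁ + 2 / Real.log T) := by
      rw [hℓ]; field_simp
    have h2 : 2 / Real.log T ≤ 1 := by rw [div_le_one hlogpos]; linarith only [hlogT, h24]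
    have h6 : 2 * π * M * l * (2 * K₁ + 2 / Real.log T) ≤ 2 * π * M * 2 * (2 * K₁ + 1) :=
      mul_le_mul (mul_le_mul_of_nonneg_left hl2 hπM) (by linarith only [h2]) (by positivity)
        (by positivity)
    rw [hE₁]; linarith only [h5, e2, h6]
  -- conclusion: `M·X ≥ c₁T/2 − M E₁ ≥ 3c₁T/8`
  have hX : c₁ * T / 2 ≤ M * (∫ s in T..2 * T,
      |(zetaZeroCount (s + ℓ) : ℝ) - zetaZeroCount s - l|) + M * E₁ :=
    hJ.trans (hD.trans (by
      linarith only [mul_le_mul_of_nonneg_left htail (by linarith only [hM] : (0 : ℝ) ≤ M)]))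
  have hTE' : 8 * M * E₁ / c₁ ≤ T := hTE
  have h9 : M * E₁ ≤ c₁ * T / 8 := by
    have := (div_le_iff₀ hc₁).1 hTE'; linarith only [this]
  rw [div_mul_eq_mul_div, div_le_iff₀ (by positivity)]
  have e3 : c₁ * T / 2 - c₁ * T / 8 = 3 * (c₁ * T / 8) := by ring
  have hc₁T : 0 ≤ c₁ * T := by positivity
  have e4 : (∫ s in T..2 * T, |(zetaZeroCount (s + ℓ) : ℝ) - zetaZeroCount s - l|) * (8 * M) =
      8 * (M * ∫ s in T..2 * T, |(zetaZeroCount (s + ℓ) : ℝ) - zetaZeroCount s - l|) := by ring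
  rw [e4]
  linarith only [hX, h9, hc₁T]

end SelbergFujii

open SelbergFujii in
/-- **Small gaps from the first moment alone (Titchmarsh §9.26, without (9.25.4)).** From the
first-moment lower bound (9.26.1),
`∫_T^{2T} |N(t + 2πλ/log T) − N(t) − λ| dt ≥ c T` for `T ≥ T₁`, uniformly in `1 ≤ λ ≤ 2`,
the named fact `Literature.NumberTheory.LFunctions.selberg_fujii_small_gaps` ((9.25.6) for a
positive proportion of `n`) follows, using otherwise only the Riemann–von Mangoldt formula
(`riemann_von_mangoldt_holds`). Unlike the large-gap half
(`selberg_fujii_large_gaps_of_first_moment`) this needs no second moment of the gaps: with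
`λ = 1 + c/4` (`c ≤ 1`), `ℓ = 2πλ/log T`, §9.26 gives `m(I) ≥ cT/8` for
`I = {t ∈ [T,2T] : N(t+ℓ) = N(t)}` and `m(I) ≤ G := Σ_{n ∈ S} (γ_{n+1} − γ_n)`,
`S = {n < N(2T) : γ_n ≥ T/2, γ_{n+1} − γ_n ≥ ℓ}`; then, with `μ = 1 − c²/160`, `w = 2πμ/log 2T`,
`V = {n < N(2T) : δ_n ≤ μ}`: `2T + C₀ ≥ Σ_{n<N(2T)} (γ_{n+1} − γ_n) ≥ G + w (N(2T) − #S − #V)`,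
`w #S ≤ (μ/λ) G` (as `ℓ #S ≤ G`), `w N(2T) ≥ 2Tμ − O(T/log T)`, whence `w #V ≥ c²T/120` and
`#V ≥ (c²/(640 π C')) N(2T)`. [cite: Titchmarsh1986, §9.26] -/
theorem selberg_fujii_small_gaps_of_first_moment
    (h1 : ∃ c : ℝ, 0 < c ∧ ∃ T₁ : ℝ, ∀ T : ℝ, T₁ ≤ T → ∀ l : ℝ, 1 ≤ l → l ≤ 2 →
      c * T ≤ ∫ t in T..2 * T,
        |(zetaZeroCount (t + 2 * π * l / Real.log T) : ℝ) - zetaZeroCount t - l|) :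
    selberg_fujii_small_gaps := by
  classical
  obtain ⟨c₀, hc₀, T₁, h1⟩ := h1
  -- shrink the constant: `c = min(c₀, 1)`
  obtain ⟨c, hc, hc1, hcc₀⟩ : ∃ c : ℝ, 0 < c ∧ c ≤ 1 ∧ c ≤ c₀ :=
    ⟨min c₀ 1, lt_min hc₀ one_pos, min_le_right _ _, min_le_left _ _⟩
  obtain ⟨K, hK, T₃, hK3⟩ := exists_zetaZeroCount_two_mul_add_one_le
  obtain ⟨C₀, hC₀, T₄, hC₀4⟩ := exists_zetaZeroCount_lt_add
  obtain ⟨C', hC', T₅, hC'5⟩ := exists_one_le_zetaZeroCount_le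
  obtain ⟨K₀, hK₀, T₆, hT₆1, hK₀6⟩ := exists_abs_zetaZeroCount_sub_le
  have hπ : 3 < π := Real.pi_gt_three
  have hC'ne : C' ≠ 0 := hC'.ne'
  -- the constants `λ = 1 + c/4`, `ν = c²/160`
  obtain ⟨lam, hlamdef⟩ : ∃ lam : ℝ, lam = 1 + c / 4 := ⟨_, rfl⟩
  have hlam1 : 1 < lam := by rw [hlamdef]; linarith only [hc]
  have hlam2 : lam ≤ 2 := by rw [hlamdef]; linarith only [hc1]
  obtain ⟨ν, hνdef⟩ : ∃ ν : ℝ, ν = c ^ 2 / 160 := ⟨_, rfl⟩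
  have hc2 : c ^ 2 ≤ 1 := by nlinarith only [hc, hc1]
  have hν0 : 0 < ν := by rw [hνdef]; positivity
  have hν1 : ν ≤ 1 / 160 := by rw [hνdef]; linarith only [hc2]
  have hfrac : c / 5 ≤ 1 - (1 - ν) / lam := by
    have hf1 : (1 - ν) / lam ≤ 1 / lam :=
      div_le_div_of_nonneg_right (by linarith only [hν0]) (by linarith only [hlam1])
    have hf2 : 1 / lam ≤ 1 - c / 5 := by
      rw [div_le_iff₀ (by linarith only [hlam1]), hlamdef]
      nlinarith only [mul_nonneg hc.le (sub_nonneg.2 hc1)]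
    linarith only [hf1, hf2]
  refine ⟨1 - ν, by linarith only [hν0], c ^ 2 / (640 * π * C'), by positivity,
    2 * max (max (max T₁ T₃) (max (T₄ + C₀) (2 * C₀)))
      (max (max T₅ T₆) (max (Real.exp (16 * π * K / c))
        (max (Real.exp (2880 / c ^ 2)) (480 * (2 * π * K₀ + C₀) / c ^ 2)))),
    fun T' hT' ↦ ?_⟩
  obtain ⟨T, rfl⟩ : ∃ T, T' = 2 * T := ⟨T' / 2, by ring⟩
  have hT := le_of_mul_le_mul_left hT' (by norm_num : (0 : ℝ) < 2)
  simp only [max_le_iff] at hT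
  obtain ⟨⟨⟨hT1, hT3⟩, hT4, hTC⟩, ⟨hT5, hT6⟩, hTK, hTe, hTKC⟩ := hT
  -- basic size facts
  have hT0 : 1 ≤ T := (Real.one_le_exp (by positivity)).trans hTe
  have hlogTc : 2880 / c ^ 2 ≤ Real.log T := by
    rw [← Real.log_exp (2880 / c ^ 2)]; exact Real.log_le_log (Real.exp_pos _) hTe
  have h2880 : (2880 : ℝ) ≤ 2880 / c ^ 2 := by
    rw [le_div_iff₀ (by positivity)]
    linarith only [mul_le_mul_of_nonneg_left hc2 (by norm_num : (0 : ℝ) ≤ 2880)]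
  have hlogT : 4 * π ≤ Real.log T := by
    have := Real.pi_lt_d2; linarith only [this, h2880, hlogTc]
  have hlogpos : 0 < Real.log T := by linarith only [hlogT, hπ]
  have hlogne : Real.log T ≠ 0 := hlogpos.ne'
  have hlogK : 16 * π * K / c ≤ Real.log T := by
    rw [← Real.log_exp (16 * π * K / c)]; exact Real.log_le_log (Real.exp_pos _) hTK
  have hlogT2T : Real.log T ≤ Real.log (2 * T) := Real.log_le_log (by positivity) (by linarith)
  have hlog2Tpos : 0 < Real.log (2 * T) := hlogpos.trans_le hlogT2T
  have hlog2Tne : Real.log (2 * T) ≠ 0 := hlog2Tpos.ne'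
  -- the shift `ℓ = 2πλ / log T ≤ 1`
  obtain ⟨ℓ, hℓdef⟩ : ∃ ℓ : ℝ, ℓ = 2 * π * lam / Real.log T := ⟨_, rfl⟩
  have hℓpos : 0 < ℓ := by rw [hℓdef]; positivity
  have hℓ1 : ℓ ≤ 1 := by
    rw [hℓdef, div_le_one hlogpos]
    linarith only [mul_le_mul_of_nonneg_left hlam2 (by positivity : (0 : ℝ) ≤ 2 * π), hlogT]
  -- Steps 1–3 of §9.26: `m(I) ≥ cT/8` for `I = {t ∈ [T,2T] | N(t+ℓ) = N(t)}`
  have hmI : c * T / 8 ≤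
      volume.real ({t | (zetaZeroCount (t + ℓ) : ℝ) = zetaZeroCount t} ∩ Icc T (2 * T)) := by
    have hS1₀ := h1 T hT1 lam hlam1.le hlam2
    rw [← hℓdef] at hS1₀
    have hS1 : c * T ≤ ∫ t in T..2 * T, |(zetaZeroCount (t + ℓ) : ℝ) - zetaZeroCount t - lam| :=
      (mul_le_mul_of_nonneg_right hcc₀ (by linarith only [hT0])).trans hS1₀
    have hS2 := integral_abs_le (T := T) (ℓ := ℓ) (by linarith only [hT0]) hℓpos.le hlam1.le
    have hS3 := integral_zetaZeroCount_shift_sub_le (T := T) hℓpos.le hℓ1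
    have hS4 := mul_le_mul_of_nonneg_left (hK3 T hT3) hℓpos.le
    have hS4' : ℓ * (T / (2 * π) * Real.log T + K * T) =
        lam * T + 2 * π * lam * K * T / Real.log T := by
      rw [hℓdef]; field_simp
    have h16 : 16 * π * K ≤ c * Real.log T := by
      have := (div_le_iff₀ hc).1 hlogK; linarith only [this]
    have hS5 : 2 * π * lam * K * T / Real.log T ≤ c * T / 4 := by
      rw [div_le_iff₀ hlogpos]
      have hA : 2 * π * lam * K * T ≤ 2 * π * 2 * K * T := by gcongr
      have hB := mul_le_mul_of_nonneg_right h16 (by positivity : (0 : ℝ) ≤ T / 4)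
      linarith only [hA, hB]
    have hlamT : (2 * lam - 2) * T ≤ c / 2 * T :=
      mul_le_mul_of_nonneg_right (by linarith only [hlamdef]) (by linarith only [hT0])
    linarith only [hS1, hS2, hS3, hS4, hS4', hS5, hlamT]
  -- Step 4: `m(I) ≤ G = Σ_{n ∈ S} (γ_{n+1} − γ_n)`
  obtain ⟨hN1, -⟩ := hC'5 T hT5
  obtain ⟨-, hN2T⟩ := hC'5 (2 * T) (by linarith only [hT5, hT0])
  set V := (Finset.range (zetaZeroCount (2 * T))).filter
      (fun n ↦ zetaNormalizedGap n ≤ 1 - ν) with hVdef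
  set S := (Finset.range (zetaZeroCount (2 * T))).filter
      (fun n ↦ T / 2 ≤ zetaOrdinate n ∧ ℓ ≤ zetaOrdinate (n + 1) - zetaOrdinate n) with hSdef
  have hSR : S ⊆ Finset.range (zetaZeroCount (2 * T)) := Finset.filter_subset _ _
  have hS6 : volume.real ({t | (zetaZeroCount (t + ℓ) : ℝ) = zetaZeroCount t} ∩ Icc T (2 * T)) ≤
      ∑ n ∈ S, (zetaOrdinate (n + 1) - zetaOrdinate n) :=
    volume_real_le_sum_gaps hℓpos.le hC₀4 (by linarith only [hT4]) hTC hN1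
  have hG : c * T / 8 ≤ ∑ n ∈ S, (zetaOrdinate (n + 1) - zetaOrdinate n) := hmI.trans hS6
  have hG0 : 0 ≤ ∑ n ∈ S, (zetaOrdinate (n + 1) - zetaOrdinate n) :=
    le_trans (by positivity) hG
  -- Step 5a: the total length of the gaps below `N(2T)`
  have hrvm := riemann_von_mangoldt_holds
  have hmono : Monotone zetaOrdinate := zetaOrdinate_mono_holds
  have hpos : ∀ n, 0 < zetaOrdinate n := zetaOrdinate_pos_holds
  have hγN : zetaOrdinate (zetaZeroCount (2 * T)) ≤ 2 * T + C₀ := by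
    have h : zetaZeroCount (2 * T) < zetaZeroCount (2 * T + C₀) :=
      hC₀4 (2 * T) (by linarith only [hT4, hC₀, hT0])
    exact hrvm.zetaOrdinate_le_iff.2 (by omega)
  have hsumR : ∑ n ∈ Finset.range (zetaZeroCount (2 * T)), (zetaOrdinate (n + 1) - zetaOrdinate n) ≤
      2 * T + C₀ := by
    rw [Finset.sum_range_sub]
    linarith only [hpos 0, hγN]
  have hsplit := Finset.sum_sdiff hSR (f := fun n ↦ zetaOrdinate (n + 1) - zetaOrdinate n)
  -- Step 5b: the gaps outside `S` that are not small have length `≥ w = 2π(1 − ν)/log 2T`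
  obtain ⟨w, hwdef⟩ : ∃ w : ℝ, w = 2 * π * (1 - ν) / Real.log (2 * T) := ⟨_, rfl⟩
  have h1ν : 0 ≤ 1 - ν := by linarith only [hν1]
  have hw0 : 0 < w := by
    rw [hwdef]; exact div_pos (mul_pos (by positivity) (by linarith only [hν1])) hlog2Tpos
  have hpt : ∀ n ∈ Finset.range (zetaZeroCount (2 * T)) \ S,
      w * (if 1 - ν < zetaNormalizedGap n then 1 else 0) ≤
        zetaOrdinate (n + 1) - zetaOrdinate n := by
    intro n hn
    rw [Finset.mem_sdiff] at hn
    have hnN : n < zetaZeroCount (2 * T) := Finset.mem_range.1 hn.1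
    have hγn : zetaOrdinate n ≤ 2 * T := hrvm.zetaOrdinate_le_iff.2 (by omega)
    have h14 : (14 : ℝ) < zetaOrdinate n :=
      lt_of_lt_of_le fourteen_lt_zetaOrdinate_zero_holds (hmono (Nat.zero_le n))
    have hgn : 0 ≤ zetaOrdinate (n + 1) - zetaOrdinate n := sub_nonneg.2 (hmono (Nat.le_succ n))
    split_ifs with hδ
    · rw [mul_one]
      have hlogn2 : Real.log (zetaOrdinate n) ≤ Real.log (2 * T) :=
        Real.log_le_log (by linarith only [h14]) hγn
      rw [zetaNormalizedGap_eq_mul_div, lt_div_iff₀ (by positivity)] at hδ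
      rw [hwdef, div_le_iff₀ hlog2Tpos]
      calc 2 * π * (1 - ν) ≤ (zetaOrdinate (n + 1) - zetaOrdinate n) * Real.log (zetaOrdinate n) := by
            linarith only [hδ]
        _ ≤ (zetaOrdinate (n + 1) - zetaOrdinate n) * Real.log (2 * T) :=
            mul_le_mul_of_nonneg_left hlogn2 hgn
    · rw [mul_zero]; exact hgn
  have hsumRS : w * (((Finset.range (zetaZeroCount (2 * T)) \ S).filter
      fun n ↦ 1 - ν < zetaNormalizedGap n).card : ℝ) ≤
      ∑ n ∈ Finset.range (zetaZeroCount (2 * T)) \ S, (zetaOrdinate (n + 1) - zetaOrdinate n) := by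
    have := Finset.sum_le_sum hpt
    rwa [← Finset.mul_sum, Finset.sum_boole] at this
  -- Step 5c: counting
  have hcard : (((Finset.range (zetaZeroCount (2 * T))).card : ℝ) - S.card) - V.card ≤
      (((Finset.range (zetaZeroCount (2 * T)) \ S).filter
        fun n ↦ 1 - ν < zetaNormalizedGap n).card : ℝ) := by
    have h1 := Finset.card_filter_add_card_filter_not
      (s := Finset.range (zetaZeroCount (2 * T)) \ S) (fun n ↦ 1 - ν < zetaNormalizedGap n)
    have h2 := Finset.card_sdiff_add_card_eq_card hSR
    have h3 : ((Finset.range (zetaZeroCount (2 * T)) \ S).filter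
        fun n ↦ ¬ (1 - ν < zetaNormalizedGap n)).card ≤ V.card := by
      apply Finset.card_le_card
      intro n hn
      simp only [Finset.mem_filter, Finset.mem_sdiff, not_lt] at hn
      rw [hVdef, Finset.mem_filter]
      exact ⟨hn.1.1, hn.2⟩
    have h4 : (Finset.range (zetaZeroCount (2 * T))).card ≤
        ((Finset.range (zetaZeroCount (2 * T)) \ S).filter
          fun n ↦ 1 - ν < zetaNormalizedGap n).card + V.card + S.card := by omega
    have h5 : ((Finset.range (zetaZeroCount (2 * T))).card : ℝ) ≤
        (((Finset.range (zetaZeroCount (2 * T)) \ S).filter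
          fun n ↦ 1 - ν < zetaNormalizedGap n).card : ℝ) + V.card + S.card := by
      exact_mod_cast h4
    linarith only [h5]
  -- Step 5d: `#S · ℓ ≤ G`, hence `w #S ≤ (μ/λ) G`
  have hSℓ : (S.card : ℝ) * ℓ ≤ ∑ n ∈ S, (zetaOrdinate (n + 1) - zetaOrdinate n) := by
    have := Finset.card_nsmul_le_sum S (fun n ↦ zetaOrdinate (n + 1) - zetaOrdinate n) ℓ
      (fun n hn ↦ (Finset.mem_filter.1 hn).2.2)
    rwa [nsmul_eq_mul] at this
  have hwle : w ≤ (1 - ν) / lam * ℓ := by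
    have e : (1 - ν) / lam * ℓ = 2 * π * (1 - ν) / Real.log T := by
      rw [hℓdef]; field_simp
    rw [e, hwdef]
    exact div_le_div_of_nonneg_left (mul_nonneg (by positivity) h1ν) hlogpos hlogT2T
  have hwS : w * S.card ≤ (1 - ν) / lam * ∑ n ∈ S, (zetaOrdinate (n + 1) - zetaOrdinate n) :=
    calc w * S.card ≤ (1 - ν) / lam * ℓ * S.card :=
          mul_le_mul_of_nonneg_right hwle (Nat.cast_nonneg _)
      _ = (1 - ν) / lam * (S.card * ℓ) := by ring
      _ ≤ (1 - ν) / lam * ∑ n ∈ S, (zetaOrdinate (n + 1) - zetaOrdinate n) :=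
          mul_le_mul_of_nonneg_left hSℓ (div_nonneg h1ν (by linarith only [hlam1]))
  have hPQ : (1 - ν) / lam * (∑ n ∈ S, (zetaOrdinate (n + 1) - zetaOrdinate n)) +
      (1 - (1 - ν) / lam) * (∑ n ∈ S, (zetaOrdinate (n + 1) - zetaOrdinate n)) =
      ∑ n ∈ S, (zetaOrdinate (n + 1) - zetaOrdinate n) := by ring
  have hQ : c ^ 2 * T / 40 ≤
      (1 - (1 - ν) / lam) * ∑ n ∈ S, (zetaOrdinate (n + 1) - zetaOrdinate n) :=
    calc c ^ 2 * T / 40 = c / 5 * (c * T / 8) := by ring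
      _ ≤ c / 5 * ∑ n ∈ S, (zetaOrdinate (n + 1) - zetaOrdinate n) :=
          mul_le_mul_of_nonneg_left hG (by positivity)
      _ ≤ (1 - (1 - ν) / lam) * ∑ n ∈ S, (zetaOrdinate (n + 1) - zetaOrdinate n) :=
          mul_le_mul_of_nonneg_right hfrac hG0
  -- Step 5e: `w N(2T) ≥ 2T(1 − ν) − 6T/log 2T − 2πK₀` (Riemann–von Mangoldt at `2T`)
  have hRc : ((Finset.range (zetaZeroCount (2 * T))).card : ℝ) = zetaZeroCount (2 * T) := by
    rw [Finset.card_range]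
  have hNlow : 2 * T / (2 * π) * (Real.log (2 * T) - Real.log (2 * π)) - 2 * T / (2 * π) -
      K₀ * Real.log (2 * T) ≤ (zetaZeroCount (2 * T) : ℝ) := by
    have h := (abs_le.1 (hK₀6 (2 * T) (by linarith only [hT6, hT0]))).1
    rw [Real.log_div (by positivity) (by positivity)] at h
    linarith only [h]
  have hwR : 2 * T - c ^ 2 * T / 80 - (6 * T / Real.log (2 * T) + 2 * π * K₀) ≤
      w * ((Finset.range (zetaZeroCount (2 * T))).card : ℝ) := by
    rw [hRc, hwdef]
    have hl2π := log_two_pi_lt_two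
    have step1 : 2 * π * (1 - ν) / Real.log (2 * T) *
        (2 * T / (2 * π) * (Real.log (2 * T) - Real.log (2 * π)) - 2 * T / (2 * π) -
          K₀ * Real.log (2 * T)) ≤ 2 * π * (1 - ν) / Real.log (2 * T) * zetaZeroCount (2 * T) :=
      mul_le_mul_of_nonneg_left hNlow (by positivity)
    have e : 2 * π * (1 - ν) / Real.log (2 * T) *
        (2 * T / (2 * π) * (Real.log (2 * T) - Real.log (2 * π)) - 2 * T / (2 * π) -
          K₀ * Real.log (2 * T)) =
        2 * T * (1 - ν) - (1 - ν) * (2 * T * (Real.log (2 * π) + 1) / Real.log (2 * T)) -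
          2 * π * (1 - ν) * K₀ := by
      field_simp; ring
    have b0 : 2 * T * (Real.log (2 * π) + 1) ≤ 6 * T := by
      have := mul_le_mul_of_nonneg_left (by linarith only [hl2π] : Real.log (2 * π) + 1 ≤ 3)
        (by linarith only [hT0] : (0 : ℝ) ≤ 2 * T)
      linarith only [this]
    have b1 : (1 - ν) * (2 * T * (Real.log (2 * π) + 1) / Real.log (2 * T)) ≤
        1 * (6 * T / Real.log (2 * T)) :=
      mul_le_mul (by linarith only [hν0]) (div_le_div_of_nonneg_right b0 hlog2Tpos.le)
        (div_nonneg (mul_nonneg (by linarith only [hT0])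
          (by linarith only [Real.log_pos (by linarith only [hπ] : (1 : ℝ) < 2 * π)]))
          hlog2Tpos.le) zero_le_one
    have b2 : 2 * π * (1 - ν) * K₀ ≤ 2 * π * K₀ := by
      have hb : 0 ≤ 2 * π * ν * K₀ := by positivity
      have eb : 2 * π * (1 - ν) * K₀ = 2 * π * K₀ - 2 * π * ν * K₀ := by ring
      linarith only [hb, eb]
    have e2 : 2 * T * (1 - ν) = 2 * T - c ^ 2 * T / 80 := by rw [hνdef]; ring
    linarith only [step1, e, b1, b2, e2]
  -- Step 5f: the two small terms
  have hlog6 : 6 * T / Real.log (2 * T) ≤ c ^ 2 * T / 480 := by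
    rw [div_le_div_iff₀ hlog2Tpos (by norm_num)]
    have h7 : 2880 / c ^ 2 ≤ Real.log (2 * T) := hlogTc.trans hlogT2T
    have h8 := (div_le_iff₀ (by positivity : (0 : ℝ) < c ^ 2)).1 h7
    have h9 := mul_le_mul_of_nonneg_left h8 (by linarith only [hT0] : (0 : ℝ) ≤ T)
    linarith only [h9]
  have hKC : 2 * π * K₀ + C₀ ≤ c ^ 2 * T / 480 := by
    rw [le_div_iff₀ (by norm_num : (0 : ℝ) < 480)]
    have := (div_le_iff₀ (by positivity : (0 : ℝ) < c ^ 2)).1 hTKC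
    linarith only [this]
  -- Step 5g: assembly, `w #V ≥ c²T/120`
  have hA4 : w * (Finset.range (zetaZeroCount (2 * T))).card - w * S.card - w * V.card ≤
      w * (((Finset.range (zetaZeroCount (2 * T)) \ S).filter
        fun n ↦ 1 - ν < zetaNormalizedGap n).card : ℝ) :=
    calc w * (Finset.range (zetaZeroCount (2 * T))).card - w * S.card - w * V.card
        = w * ((((Finset.range (zetaZeroCount (2 * T))).card : ℝ) - S.card) - V.card) := by ring
      _ ≤ _ := mul_le_mul_of_nonneg_left hcard hw0.le
  have hmain : c ^ 2 * T / 120 ≤ w * V.card := by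
    linarith only [hsumR, hsplit, hsumRS, hA4, hwS, hPQ, hQ, hwR, hlog6, hKC]
  -- Step 5h: `#V ≥ c² T log 2T/(240π) ≥ A N(2T)`
  have hV : c ^ 2 * T * Real.log (2 * T) / (240 * π) ≤ V.card := by
    have h1 : w * V.card ≤ 2 * π / Real.log (2 * T) * V.card := by
      apply mul_le_mul_of_nonneg_right _ (Nat.cast_nonneg _)
      rw [hwdef]
      apply div_le_div_of_nonneg_right _ hlog2Tpos.le
      have hb : 0 ≤ 2 * π * ν := by positivity
      have eb : 2 * π * (1 - ν) = 2 * π - 2 * π * ν := by ring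
      linarith only [hb, eb]
    have h2 : c ^ 2 * T / 120 ≤ 2 * π / Real.log (2 * T) * V.card := hmain.trans h1
    rw [div_mul_eq_mul_div, le_div_iff₀ hlog2Tpos] at h2
    rw [div_le_iff₀ (by positivity)]
    linarith only [h2]
  calc c ^ 2 / (640 * π * C') * (zetaZeroCount (2 * T) : ℝ)
      ≤ c ^ 2 / (640 * π * C') * (C' * (2 * T * Real.log (2 * T))) := by gcongr
    _ = c ^ 2 * T * Real.log (2 * T) / (320 * π) := by field_simp; ring
    _ ≤ c ^ 2 * T * Real.log (2 * T) / (240 * π) := by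
        apply div_le_div_of_nonneg_left (by positivity) (by positivity)
        linarith only [Real.pi_pos]
    _ ≤ V.card := hV

open SelbergFujii in
/-- **Selberg–Fujii small gaps from the `L¹` bound for `S(t+h) − S(t)`.** If for some fixed
`M ∈ ℕ`, `M ≥ 1`, `c₁ > 0`: `∫_T^{2T} |S(t+h) − S(t)| dt ≥ c₁ T` for all large `T` and all `h`
with `2πM ≤ h log T ≤ 4πM`, then the named fact
`Literature.NumberTheory.LFunctions.selberg_fujii_small_gaps` ((9.25.6)) holds. This displayed
`L¹` bound is the entire remaining (unproved, unvendored) input for the small-gap fact; in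
§9.25–9.26 it is obtained from Fujii's (9.25.2)–(9.25.3), i.e. from Selberg's theory of `S(t)`.
[cite: Titchmarsh1986, §9.26] -/
theorem selberg_fujii_small_gaps_of_abs_moment
    (hS : ∃ M : ℕ, 1 ≤ M ∧ ∃ c₁ : ℝ, 0 < c₁ ∧ ∃ T₀ : ℝ, ∀ T : ℝ, T₀ ≤ T → ∀ h : ℝ,
      2 * π * M ≤ h * Real.log T → h * Real.log T ≤ 4 * π * M →
        c₁ * T ≤ ∫ t in T..2 * T, |zetaArgS (t + h) - zetaArgS t|) :
    selberg_fujii_small_gaps :=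
  selberg_fujii_small_gaps_of_first_moment (first_moment_of_abs_moment hS)

open SelbergFujii in
/-- **Selberg–Fujii large gaps from the `L¹` bound for `S(t+h) − S(t)` and (9.25.4)₂.**
[cite: Titchmarsh1986, §9.26] -/
theorem selberg_fujii_large_gaps_of_abs_moment
    (hS : ∃ M : ℕ, 1 ≤ M ∧ ∃ c₁ : ℝ, 0 < c₁ ∧ ∃ T₀ : ℝ, ∀ T : ℝ, T₀ ≤ T → ∀ h : ℝ,
      2 * π * M ≤ h * Real.log T → h * Real.log T ≤ 4 * π * M →
        c₁ * T ≤ ∫ t in T..2 * T, |zetaArgS (t + h) - zetaArgS t|)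
    (h254 : ∃ C : ℝ, ∃ T₂ : ℝ, ∀ T : ℝ, T₂ ≤ T →
      ∑ n ∈ Finset.range (zetaZeroCount T), (zetaOrdinate (n + 1) - zetaOrdinate n) ^ 2 ≤
        C * (zetaZeroCount T : ℝ) / (Real.log T) ^ 2) :
    selberg_fujii_large_gaps :=
  selberg_fujii_large_gaps_of_first_moment (first_moment_of_abs_moment hS) h254

open SelbergFujii in
/-- **Selberg–Fujii small gaps from Fujii's (9.25.2) and (9.25.3)₂ only** (no (9.25.4)):
through `SelbergFujii.first_moment_of_moments` and `selberg_fujii_small_gaps_of_first_moment`.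
[cite: Titchmarsh1986, §9.25 (9.25.2)–(9.25.3), (9.25.6) and §9.26] -/
theorem selberg_fujii_small_gaps_of_moments'
    (h252 : ∃ A : ℝ, ∃ T₀ : ℝ, ∀ T : ℝ, T₀ ≤ T → ∀ h : ℝ, 0 ≤ h → h ≤ T / 2 →
      |(∫ t in (0 : ℝ)..T, (zetaArgS (t + h) - zetaArgS t) ^ 2) -
          T * Real.log (3 + h * Real.log T) / π ^ 2| ≤
        A * (T * Real.sqrt (Real.log (3 + h * Real.log T))))
    (h253 : ∃ A : ℝ, ∃ T₀ : ℝ, ∀ T : ℝ, T₀ ≤ T → ∀ h : ℝ, 0 ≤ h → h ≤ T / 2 →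
      ∫ t in (0 : ℝ)..T, (zetaArgS (t + h) - zetaArgS t) ^ 4 ≤
        T * (A * Real.log (3 + h * Real.log T)) ^ 2) :
    selberg_fujii_small_gaps :=
  selberg_fujii_small_gaps_of_first_moment (first_moment_of_moments h252 h253)

end Literature.NumberTheory.LFunctions

end
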